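import Summits.QuantumFields.YangMills.Theorems.BalabanUVNodesN07AliasSumMarginSharp
import Summits.QuantumFields.YangMills.Theorems.BalabanUVNodesN07AliasSumMarginSigned
import HarnessLib

/-!
# DAG node N07 (road R0′ at the record; the `hker` ∕ `hpos` letter) — THE SHARP ONE-LEVEL MARGIN, part 4 (adapter):
# «K₀ ≤ K» with constant ONE in the RAW letters of `…OneLevelSymbol.signed_alias_sum_pos` (dag-n07-w5's `hDisp` socket at `c₁ = 1`)

Width seat `pub-ymgap-dag-n07-w7` (g5), `--supports stmt-QuantumFields-27364 --as helper`; count-neutral; 0 `def`.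
Part 3 (`…N07AliasSumMarginSharp`) proves `matchedSymbol_le_aliasSymbolK_sharp` («`K₀(θ) ≤ K(θ)`», every odd block side `L ≥ 3`, every
finite `J`); THIS FILE rewrites it in the signed ∕ `Sxir` letters of dag-n07-w5's one-level symbol files through this lineage's termwise
conversions `centreSummand_signedLetters` ∕ `matchedSummand_signedLetters` (g4, `…N07AliasSumMarginSigned`): ★★ `displayMargin_signedLetters_sharp`
(g4's `displayMargin_signedLetters` WITHOUT `(π^{|J|})⁻¹`), `…_sharp'` (square of the product), ★★ `displayMargin_sharp_hDisp` (dag-n07-w5 g2's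
`hDisp` binder of `…OneLevelSymbolBridge.symbolMargin_of_display` at `c₁ = 1`, asked for on the cell bus 11:41Z — their x-space corollary
«`‖Δ⁻¹Q′ᴴβ‖² ≤ Re Σ_y conj β(y)(Δ⁻²Q′ᴴβ)(ny+c₀)`» for every odd `n ≥ 3` is then one `exact`), `displayMargin_sharp_hDisp'` (no unit constant).

HONEST SCOPE.  Bookkeeping only ([folklore]); nothing of [B11]∕[B6]∕[3] is asserted; (L2), (L4), `(P)_D` OPEN; `hker`, stub 1, K0⁷∕K1⁹
NOT closed; N07 not discharged; nothing continuum ∕ OS ∕ mass gap ∕ Clay.  Context: T. Bałaban, CMP **96** (1984) 223–250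
[Balaban1984PropagatorsII] (2.22) p.226 — nothing is cited as a hypothesis.
-/

set_option autoImplicit false

noncomputable section

open Finset

namespace Summit.QuantumFields.YangMills.Theorems.N07AliasSumMarginSharp

open Summit.QuantumFields.YangMills.Theorems.N07AliasSumPositivity
open Summit.QuantumFields.YangMills.Theorems.N07AliasSumMargin

/-! ## §7  The sharp margin in the signed ∕ `Sxir` letters (dag-n07-w5's `hDisp` socket at `c₁ = 1`) -/

section Signed

open Literature.MathematicalPhysics.QuantumFieldTheory.Balaban1983to89

/-- ★★ **The SHARP display margin in the RAW letters of `signed_alias_sum_pos` (product of squares).**  For a finite `J`, odd `n ≥ 3`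
and `θ ∈ (0,2π)^J`:
`Σ_{m : J → Fin n} (Π_κ f(θ_κ,m_κ)²) ∕ (Σ_κ Sxir n (θ_κ + 2πm_κ))² ≤ Σ_m (Π_κ f(θ_κ,m_κ)) ∕ (Σ_κ Sxir n (θ_κ + 2πm_κ))²`,
`f(θ,m) = sin((θ+2πm)∕2)∕(n sin((θ+2πm)∕(2n)))` — `matchedSymbol_le_aliasSymbolK_sharp` after this lineage's termwise conversions
`centreSummand_signedLetters` ∕ `matchedSummand_signedLetters` (g4); g4's `displayMargin_signedLetters` WITHOUT the factor `(π^{|J|})⁻¹`.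
[folklore] -/
theorem displayMargin_signedLetters_sharp {J : Type*} [Fintype J] [DecidableEq J] {n : ℕ} (hn : Odd n) (h3 : 3 ≤ n)
    (θ : J → ℝ) (hθ : ∀ κ, 0 < θ κ ∧ θ κ < 2 * Real.pi) :
    ∑ m : J → Fin n,
        (∏ κ, (Real.sin ((θ κ + 2 * Real.pi * (m κ : ℕ)) / 2) /
          ((n : ℝ) * Real.sin ((θ κ + 2 * Real.pi * (m κ : ℕ)) / (2 * n)))) ^ 2) /
          (∑ κ, B4Strip.Sxir n (θ κ + 2 * Real.pi * (m κ : ℕ))) ^ 2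
      ≤ ∑ m : J → Fin n, (∏ κ, Real.sin ((θ κ + 2 * Real.pi * (m κ : ℕ)) / 2) /
          ((n : ℝ) * Real.sin ((θ κ + 2 * Real.pi * (m κ : ℕ)) / (2 * n)))) /
          (∑ κ, B4Strip.Sxir n (θ κ + 2 * Real.pi * (m κ : ℕ))) ^ 2 := by
  have hn0 : (0 : ℝ) < n := by exact_mod_cast (show 0 < n by omega)
  simp_rw [centreSummand_signedLetters, matchedSummand_signedLetters, ← Finset.mul_sum]
  exact mul_le_mul_of_nonneg_left (matchedSymbol_le_aliasSymbolK_sharp hn h3 θ hθ) (by positivity)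

/-- The same sharp display margin with the SQUARE OF THE PRODUCT on the matched side (`Finset.prod_pow`). [folklore] -/
theorem displayMargin_signedLetters_sharp' {J : Type*} [Fintype J] [DecidableEq J] {n : ℕ} (hn : Odd n) (h3 : 3 ≤ n)
    (θ : J → ℝ) (hθ : ∀ κ, 0 < θ κ ∧ θ κ < 2 * Real.pi) :
    ∑ m : J → Fin n,
        (∏ κ, Real.sin ((θ κ + 2 * Real.pi * (m κ : ℕ)) / 2) /
          ((n : ℝ) * Real.sin ((θ κ + 2 * Real.pi * (m κ : ℕ)) / (2 * n)))) ^ 2 /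
          (∑ κ, B4Strip.Sxir n (θ κ + 2 * Real.pi * (m κ : ℕ))) ^ 2
      ≤ ∑ m : J → Fin n, (∏ κ, Real.sin ((θ κ + 2 * Real.pi * (m κ : ℕ)) / 2) /
          ((n : ℝ) * Real.sin ((θ κ + 2 * Real.pi * (m κ : ℕ)) / (2 * n)))) /
          (∑ κ, B4Strip.Sxir n (θ κ + 2 * Real.pi * (m κ : ℕ))) ^ 2 := by
  simp_rw [← Finset.prod_pow]
  exact displayMargin_signedLetters_sharp hn h3 θ hθ

/-- ★★ **dag-n07-w5's `hDisp` socket at `c₁ = 1`, letter for letter** (`…OneLevelSymbolBridge.symbolMargin_of_display`, p626779; compare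
g4's `displayMargin_hDisp` at `c₁ = π⁻¹`): for every non-empty finite `J : Type`, `θ ∈ (0,2π)^J` and odd `n ≥ 3`,
`1 ^ |J| · Σ_m (Π_κ f(θ_κ,m_κ)²) ∕ (Σ_κ Sxir n (θ_κ+2πm_κ))² ≤ Σ_m (Π_κ f(θ_κ,m_κ)) ∕ (Σ_κ Sxir n (θ_κ+2πm_κ))²`. [folklore] -/
theorem displayMargin_sharp_hDisp {n : ℕ} (hn : Odd n) (h3 : 3 ≤ n) :
    ∀ (J : Type) [Fintype J] [DecidableEq J] [Nonempty J] (θ : J → ℝ),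
      (∀ κ, 0 < θ κ ∧ θ κ < 2 * Real.pi) →
      (1 : ℝ) ^ Fintype.card J * ∑ m : J → Fin n,
          (∏ κ, (Real.sin ((θ κ + 2 * Real.pi * (m κ : ℕ)) / 2) /
            ((n : ℝ) * Real.sin ((θ κ + 2 * Real.pi * (m κ : ℕ)) / (2 * n)))) ^ 2) /
            (∑ κ, B4Strip.Sxir n (θ κ + 2 * Real.pi * (m κ : ℕ))) ^ 2
        ≤ ∑ m : J → Fin n, (∏ κ, Real.sin ((θ κ + 2 * Real.pi * (m κ : ℕ)) / 2) /
            ((n : ℝ) * Real.sin ((θ κ + 2 * Real.pi * (m κ : ℕ)) / (2 * n)))) /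
            (∑ κ, B4Strip.Sxir n (θ κ + 2 * Real.pi * (m κ : ℕ))) ^ 2 := by
  intro J _ _ _ θ hθ
  rw [one_pow, one_mul]
  exact displayMargin_signedLetters_sharp hn h3 θ hθ

/-- The `hDisp` socket without the unit constant: `Σ_m (Π_κ f²)∕(Σ Sxir)² ≤ Σ_m (Π_κ f)∕(Σ Sxir)²` for every non-empty finite `J : Type`.
[folklore] -/
theorem displayMargin_sharp_hDisp' {n : ℕ} (hn : Odd n) (h3 : 3 ≤ n) :
    ∀ (J : Type) [Fintype J] [DecidableEq J] [Nonempty J] (θ : J → ℝ),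
      (∀ κ, 0 < θ κ ∧ θ κ < 2 * Real.pi) →
      ∑ m : J → Fin n,
          (∏ κ, (Real.sin ((θ κ + 2 * Real.pi * (m κ : ℕ)) / 2) /
            ((n : ℝ) * Real.sin ((θ κ + 2 * Real.pi * (m κ : ℕ)) / (2 * n)))) ^ 2) /
            (∑ κ, B4Strip.Sxir n (θ κ + 2 * Real.pi * (m κ : ℕ))) ^ 2
        ≤ ∑ m : J → Fin n, (∏ κ, Real.sin ((θ κ + 2 * Real.pi * (m κ : ℕ)) / 2) /
            ((n : ℝ) * Real.sin ((θ κ + 2 * Real.pi * (m κ : ℕ)) / (2 * n)))) /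
            (∑ κ, B4Strip.Sxir n (θ κ + 2 * Real.pi * (m κ : ℕ))) ^ 2 := by
  intro J _ _ _ θ hθ
  exact displayMargin_signedLetters_sharp hn h3 θ hθ

end Signed

end Summit.QuantumFields.YangMills.Theorems.N07AliasSumMarginSharp

end
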